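import Mathlib

/-!
HONEST FRAMING: exact (Metropolis-corrected) sampling algorithms for lattice gauge theory; figures of
merit are autocorrelation/cost numbers at stated couplings and volumes; no continuum-physics claim.

# Slot representations — the Kronecker calculus of the Peter–Weyl-free route to THEOREM A

THEORY-1 §19 (GEN-10), fact (E1).  A SLOT SYSTEM over a set of links `E` is a finite type `σ` of slots with
a link map `lnk : σ → E` and a polarity `pol : σ → Bool`; for an ambient configuration
`W : E → Matrix (Fin n) (Fin n) ℂ` the SLOT REPRESENTATION is the Kronecker product `R_σ(W) = ⊗ₛ Ŵₛ`,
`Ŵₛ = W (lnk s)` (polarity `true`) or its entrywise conjugate (`false`), a matrix on multi-indices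
`σ → Fin n` with `R_σ(W)_{I,J} = ∏ₛ Ŵₛ (I s) (J s)`.  Every term of Lüscher's series `S̃^{(k)}` is a matrix
coefficient `W ↦ z ⟪R_σ(W) v, w⟫` (THEORY-1 §19.1); this file is the algebra making such coefficient
functions closed under products and link derivatives: §1 `kronPi` — multiplicativity
`⊗(AₛBₛ) = (⊗Aₛ)(⊗Bₛ)` for ALL matrices, unit, `ᴴ`, unitarity, and disjoint union of slot systems =
Kronecker product; §2 polarities and `slotRep`, multiplicative in `W`; §3 insertions
`ins s Z = 1 ⊗ ⋯ ⊗ Z ⊗ ⋯ ⊗ 1` and SLOT GENERATORS `slotGen lnk pol e Y = ∑_{lnk s = e} ins s (Y or Ȳ)`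
(different links commute, skew-Hermitian for skew-Hermitian `Y`, a Lie homomorphism in `Y`); §4 the
DERIVATIVE FORMULA: along the link curve `t ↦ update W e (exp(tY) W e)` every entry of `R_σ` has derivative
`(slotGen e Y · R_σ(W))_{I,J}` at `t = 0`, for every ambient `W`, so link derivatives of coefficient
functions are coefficient functions.  Mathlib only, no `sorry`, matrix level throughout (the Hilbert-space
packaging and the Casimir grading of `CasimirGrading.lean` are joined in `SlotCasimir.lean`).
References: M. Lüscher, Commun. Math. Phys. 293 (2010) 899 [arXiv:0907.5491], §2.2 and App. A (link
derivatives); THEORY-1 §19.  Tags: [folklore] = standard multilinear algebra, [ours] = venture bookkeeping.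
-/

open scoped ComplexConjugate Kronecker
open Matrix Finset

namespace Summit.Ventures.LatticeQCDFlow.TrivializingMaps.SlotRepresentation

variable {σ : Type*} [Fintype σ] {n : ℕ}
/-! ## §1. Kronecker products over a finite slot type -/
section KronPi
/-- The Kronecker product `⊗ₛ A s` of a finite family of `n × n` matrices, as a matrix on multi-indices
`σ → Fin n`: `(kronPi A) I J = ∏ₛ A s (I s) (J s)`. [folklore] -/
def kronPi (A : σ → Matrix (Fin n) (Fin n) ℂ) : Matrix (σ → Fin n) (σ → Fin n) ℂ :=
  Matrix.of fun I J => ∏ s, A s (I s) (J s)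
/-- Entries of a Kronecker product. [folklore] -/
@[simp] theorem kronPi_apply (A : σ → Matrix (Fin n) (Fin n) ℂ) (I J : σ → Fin n) :
    kronPi A I J = ∏ s, A s (I s) (J s) := rfl

/-- **Multiplicativity** `⊗ₛ(A s * B s) = (⊗ₛ A s) * (⊗ₛ B s)` — for arbitrary matrices. [folklore] -/
theorem kronPi_mul [DecidableEq σ] (A B : σ → Matrix (Fin n) (Fin n) ℂ) :
    kronPi (fun s => A s * B s) = kronPi A * kronPi B := by
  ext I J
  simp only [kronPi_apply, Matrix.mul_apply]
  rw [Fintype.prod_sum (fun s k => A s (I s) k * B s k (J s))]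
  refine Finset.sum_congr rfl fun K _ => ?_
  rw [Finset.prod_mul_distrib]

/-- `⊗ₛ 1 = 1`. [folklore] -/
theorem kronPi_one : kronPi (fun _ : σ => (1 : Matrix (Fin n) (Fin n) ℂ)) = 1 := by
  ext I J; simp only [kronPi_apply, Matrix.one_apply]; rw [Fintype.prod_boole]; simp [funext_iff]

/-- `(⊗ₛ A s)ᴴ = ⊗ₛ (A s)ᴴ`. [folklore] -/
theorem kronPi_conjTranspose (A : σ → Matrix (Fin n) (Fin n) ℂ) :
    (kronPi A)ᴴ = kronPi (fun s => (A s)ᴴ) := by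
  ext I J; simp only [conjTranspose_apply, kronPi_apply, star_prod]

/-- A Kronecker product of unitary matrices is unitary. [folklore] -/
theorem kronPi_mem_unitaryGroup [DecidableEq σ] {A : σ → Matrix (Fin n) (Fin n) ℂ}
    (hA : ∀ s, A s ∈ Matrix.unitaryGroup (Fin n) ℂ) :
    kronPi A ∈ Matrix.unitaryGroup (σ → Fin n) ℂ := by
  rw [Matrix.mem_unitaryGroup_iff']
  change (kronPi A)ᴴ * kronPi A = 1
  rw [kronPi_conjTranspose, ← kronPi_mul]
  have : (fun s => (A s)ᴴ * A s) = fun _ => (1 : Matrix (Fin n) (Fin n) ℂ) := by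
    funext s
    exact (Matrix.mem_unitaryGroup_iff').1 (hA s)
  rw [this, kronPi_one]

/-- Kronecker products depend only on the family (congruence helper). [folklore] -/
theorem kronPi_congr {A B : σ → Matrix (Fin n) (Fin n) ℂ} (h : ∀ s, A s = B s) : kronPi A = kronPi B := by
  rw [show A = B from funext h]

/-- **Disjoint union of slot systems = Kronecker product**: re-indexing multi-indices on `σ ⊕ σ'` as pairs,
`⊗_{σ⊔σ'} = (⊗_σ) ⊗ₖ (⊗_{σ'})`. [folklore] -/
theorem kronPi_sum_reindex {σ' : Type*} [Fintype σ']
    (A : σ → Matrix (Fin n) (Fin n) ℂ) (B : σ' → Matrix (Fin n) (Fin n) ℂ) :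
    Matrix.reindex (Equiv.sumArrowEquivProdArrow σ σ' (Fin n)) (Equiv.sumArrowEquivProdArrow σ σ' (Fin n))
        (kronPi (Sum.elim A B)) = kronPi A ⊗ₖ kronPi B := by
  ext ⟨I, I'⟩ ⟨J, J'⟩
  simp [kronPi_apply, Matrix.kroneckerMap_apply, Fintype.prod_sum_type, Equiv.sumArrowEquivProdArrow]
end KronPi

/-! ## §2. Polarities and the slot representation -/
section SlotRep
/-- Apply a polarity: `true` ↦ the matrix itself, `false` ↦ its entrywise complex conjugate
(the conjugate representation `U ↦ Ū`). [folklore] -/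
def polM (b : Bool) (M : Matrix (Fin n) (Fin n) ℂ) : Matrix (Fin n) (Fin n) ℂ :=
  if b then M else M.map (starRingEnd ℂ)
/-- Polarity `true` is the identity. [folklore] -/
@[simp] theorem polM_true (M : Matrix (Fin n) (Fin n) ℂ) : polM true M = M := rfl
/-- Polarity `false` is entrywise conjugation. [folklore] -/
@[simp] theorem polM_false (M : Matrix (Fin n) (Fin n) ℂ) : polM false M = M.map (starRingEnd ℂ) := rfl
/-- Polarities are multiplicative. [folklore] -/
theorem polM_mul (b : Bool) (M N : Matrix (Fin n) (Fin n) ℂ) : polM b (M * N) = polM b M * polM b N := by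
  cases b
  · simp [Matrix.map_mul]
  · simp
/-- Polarities fix `1`. [folklore] -/
theorem polM_one (b : Bool) : polM b (1 : Matrix (Fin n) (Fin n) ℂ) = 1 := by
  cases b <;> simp
/-- Polarities are additive. [folklore] -/
theorem polM_add (b : Bool) (M N : Matrix (Fin n) (Fin n) ℂ) : polM b (M + N) = polM b M + polM b N := by
  cases b <;> simp [Matrix.map_add]
/-- Polarities are real-linear. [folklore] -/
theorem polM_smul_real (b : Bool) (r : ℝ) (M : Matrix (Fin n) (Fin n) ℂ) : polM b (r • M) = r • polM b M := by
  cases b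
  · ext i j
    simp [Matrix.map_apply, Complex.real_smul]
  · simp
/-- Polarities commute with `ᴴ`. [folklore] -/
theorem polM_conjTranspose (b : Bool) (M : Matrix (Fin n) (Fin n) ℂ) : polM b Mᴴ = (polM b M)ᴴ := by
  cases b
  · simp only [polM_false]
    ext i j
    simp [Matrix.map_apply, conjTranspose_apply]
  · simp
/-- Polarities preserve unitarity. [folklore] -/
theorem polM_mem_unitaryGroup (b : Bool) {M : Matrix (Fin n) (Fin n) ℂ} (hM : M ∈ Matrix.unitaryGroup (Fin n) ℂ) :
    polM b M ∈ Matrix.unitaryGroup (Fin n) ℂ := by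
  rw [Matrix.mem_unitaryGroup_iff'] at hM ⊢
  change (polM b M)ᴴ * polM b M = 1
  rw [← polM_conjTranspose, ← polM_mul]
  change polM b (star M * M) = 1
  rw [hM, polM_one]

variable {E : Type*}
/-- The **slot representation** `R_σ(W) = ⊗ₛ Ŵₛ` of a slot system `(lnk, pol)` over the links `E`, on an
ambient configuration `W : E → M_n(ℂ)`. [ours] -/
def slotRep (lnk : σ → E) (pol : σ → Bool) (W : E → Matrix (Fin n) (Fin n) ℂ) :
    Matrix (σ → Fin n) (σ → Fin n) ℂ :=
  kronPi fun s => polM (pol s) (W (lnk s))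

/-- `R_σ` is multiplicative in the configuration (pointwise product of link matrices) — on ALL ambient
configurations. [folklore] -/
theorem slotRep_mul [DecidableEq σ] (lnk : σ → E) (pol : σ → Bool) (W W' : E → Matrix (Fin n) (Fin n) ℂ) :
    slotRep lnk pol (fun e => W e * W' e) = slotRep lnk pol W * slotRep lnk pol W' := by
  unfold slotRep; rw [← kronPi_mul]; exact kronPi_congr fun s => polM_mul _ _ _
/-- `R_σ(1) = 1`. [folklore] -/
theorem slotRep_one (lnk : σ → E) (pol : σ → Bool) :
    slotRep lnk pol (fun _ => (1 : Matrix (Fin n) (Fin n) ℂ)) = 1 := by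
  unfold slotRep; rw [← kronPi_one (σ := σ) (n := n)]; exact kronPi_congr fun _ => polM_one _
/-- `R_σ(Wᴴ) = R_σ(W)ᴴ`. [folklore] -/
theorem slotRep_conjTranspose (lnk : σ → E) (pol : σ → Bool) (W : E → Matrix (Fin n) (Fin n) ℂ) :
    (slotRep lnk pol W)ᴴ = slotRep lnk pol (fun e => (W e)ᴴ) := by
  unfold slotRep; rw [kronPi_conjTranspose]; exact kronPi_congr fun _ => (polM_conjTranspose _ _).symm
/-- `R_σ(U)` is unitary on unitary configurations (so `‖R_σ(U)‖ = 1`). [folklore] -/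
theorem slotRep_mem_unitaryGroup [DecidableEq σ] (lnk : σ → E) (pol : σ → Bool) {U : E → Matrix (Fin n) (Fin n) ℂ}
    (hU : ∀ e, U e ∈ Matrix.unitaryGroup (Fin n) ℂ) :
    slotRep lnk pol U ∈ Matrix.unitaryGroup (σ → Fin n) ℂ :=
  kronPi_mem_unitaryGroup fun _ => polM_mem_unitaryGroup _ (hU _)
end SlotRep

/-! ## §3. Slot insertions and slot generators -/
section Generators
variable [DecidableEq σ]
/-- Entries of a Kronecker product with one factor replaced. [folklore] -/
theorem kronPi_update_apply (A : σ → Matrix (Fin n) (Fin n) ℂ) (s : σ) (Z : Matrix (Fin n) (Fin n) ℂ)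
    (I J : σ → Fin n) :
    kronPi (Function.update A s Z) I J = Z (I s) (J s) * ∏ s' ∈ univ.erase s, A s' (I s') (J s') := by
  rw [kronPi_apply, ← Finset.mul_prod_erase univ _ (mem_univ s), Function.update_self]
  congr 1
  exact Finset.prod_congr rfl fun s' hs' => by rw [Function.update_of_ne (ne_of_mem_erase hs')]

/-- The **insertion** `ins s Z = 1 ⊗ ⋯ ⊗ Z ⊗ ⋯ ⊗ 1` of a matrix at slot `s`. [folklore] -/
def ins (s : σ) (Z : Matrix (Fin n) (Fin n) ℂ) : Matrix (σ → Fin n) (σ → Fin n) ℂ :=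
  kronPi (Function.update (fun _ => (1 : Matrix (Fin n) (Fin n) ℂ)) s Z)

/-- `ins s Z * ⊗ₛ' A s' = ⊗ (A with Z·A s at slot s)`. [folklore] -/
theorem ins_mul_kronPi (s : σ) (Z : Matrix (Fin n) (Fin n) ℂ) (A : σ → Matrix (Fin n) (Fin n) ℂ) :
    ins s Z * kronPi A = kronPi (Function.update A s (Z * A s)) := by
  rw [ins, ← kronPi_mul]
  refine kronPi_congr fun s' => ?_
  rcases eq_or_ne s' s with rfl | h
  · simp
  · simp [Function.update_of_ne h]
/-- Insertion is multiplicative. [folklore] -/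
theorem ins_mul (s : σ) (Z Z' : Matrix (Fin n) (Fin n) ℂ) : ins s (Z * Z') = ins s Z * ins s Z' := by
  rw [ins, ins, ins, ← kronPi_mul]
  refine kronPi_congr fun s' => ?_
  rcases eq_or_ne s' s with rfl | h
  · simp
  · simp [Function.update_of_ne h]
/-- Insertion commutes with `ᴴ`. [folklore] -/
theorem ins_conjTranspose (s : σ) (Z : Matrix (Fin n) (Fin n) ℂ) : (ins s Z)ᴴ = ins s Zᴴ := by
  rw [ins, ins, kronPi_conjTranspose]
  refine kronPi_congr fun s' => ?_
  rcases eq_or_ne s' s with rfl | h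
  · simp
  · simp [Function.update_of_ne h]
/-- Entries of an insertion. [folklore] -/
theorem ins_apply (s : σ) (Z : Matrix (Fin n) (Fin n) ℂ) (I J : σ → Fin n) :
    ins s Z I J = Z (I s) (J s) * ∏ s' ∈ univ.erase s, (1 : Matrix (Fin n) (Fin n) ℂ) (I s') (J s') := by
  rw [ins, kronPi_update_apply]
/-- Insertion is additive. [folklore] -/
theorem ins_add (s : σ) (Z Z' : Matrix (Fin n) (Fin n) ℂ) : ins s (Z + Z') = ins s Z + ins s Z' := by
  ext I J; simp only [ins_apply, Matrix.add_apply]; ring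
/-- Insertion is `ℂ`-homogeneous. [folklore] -/
theorem ins_smul (s : σ) (c : ℂ) (Z : Matrix (Fin n) (Fin n) ℂ) : ins s (c • Z) = c • ins s Z := by
  ext I J; simp only [ins_apply, Matrix.smul_apply, smul_eq_mul]; ring
/-- Insertion respects subtraction. [folklore] -/
theorem ins_sub (s : σ) (Z Z' : Matrix (Fin n) (Fin n) ℂ) : ins s (Z - Z') = ins s Z - ins s Z' := by
  rw [sub_eq_add_neg, ins_add, ← neg_one_smul ℂ Z', ins_smul, neg_one_smul, sub_eq_add_neg]
/-- Insertions at DIFFERENT slots commute. [folklore] -/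
theorem ins_mul_ins_comm {s s' : σ} (h : s ≠ s') (Z Z' : Matrix (Fin n) (Fin n) ℂ) :
    ins s Z * ins s' Z' = ins s' Z' * ins s Z := by
  rw [ins, ins, ← kronPi_mul, ← kronPi_mul]
  refine kronPi_congr fun t => ?_
  rcases eq_or_ne t s with rfl | ht
  · simp [Function.update_of_ne h]
  · rcases eq_or_ne t s' with rfl | ht'
    · simp [Function.update_of_ne (Ne.symm h)]
    · simp [Function.update_of_ne ht, Function.update_of_ne ht']

/-- `[ins s Z, ins s Z'] = ins s [Z, Z']` (insertion is an algebra map). [folklore] -/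
theorem ins_commutator (s : σ) (Z Z' : Matrix (Fin n) (Fin n) ℂ) :
    ins s Z * ins s Z' - ins s Z' * ins s Z = ins s (Z * Z' - Z' * Z) := by
  rw [ins_sub, ins_mul, ins_mul]

variable {E : Type*} [DecidableEq E]
/-- The **slot generator** of a link: `Y^{σ,e} = ∑_{lnk s = e} ins s (Y or Ȳ)` — the infinitesimal action of
left multiplication `W e ↦ exp(tY) W e` in the slot representation (§4). [ours] -/
def slotGen (lnk : σ → E) (pol : σ → Bool) (e : E) (Y : Matrix (Fin n) (Fin n) ℂ) :
    Matrix (σ → Fin n) (σ → Fin n) ℂ :=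
  ∑ s, if lnk s = e then ins s (polM (pol s) Y) else 0
/-- `(Y^{σ,e})ᴴ = (Yᴴ)^{σ,e}`. [folklore] -/
theorem slotGen_conjTranspose (lnk : σ → E) (pol : σ → Bool) (e : E) (Y : Matrix (Fin n) (Fin n) ℂ) :
    (slotGen lnk pol e Y)ᴴ = slotGen lnk pol e Yᴴ := by
  simp only [slotGen, Matrix.conjTranspose_sum]
  refine Finset.sum_congr rfl fun s _ => ?_
  split_ifs
  · rw [ins_conjTranspose, polM_conjTranspose]
  · simp

/-- Slot generators of skew-Hermitian matrices are skew-Hermitian. [folklore] -/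
theorem slotGen_conjTranspose_of_skew (lnk : σ → E) (pol : σ → Bool) (e : E) {Y : Matrix (Fin n) (Fin n) ℂ}
    (hY : Yᴴ = -Y) : (slotGen lnk pol e Y)ᴴ = -slotGen lnk pol e Y := by
  rw [slotGen_conjTranspose, hY]
  simp only [slotGen, ← Finset.sum_neg_distrib]
  refine Finset.sum_congr rfl fun s _ => ?_
  split_ifs
  · rw [← neg_one_smul ℂ Y, show polM (pol s) ((-1 : ℂ) • Y) = (-1 : ℂ) • polM (pol s) Y by
      cases pol s <;> simp [Matrix.map_neg], ins_smul, neg_one_smul]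
  · simp
/-- Slot generators are additive in `Y`. [folklore] -/
theorem slotGen_add (lnk : σ → E) (pol : σ → Bool) (e : E) (Y Y' : Matrix (Fin n) (Fin n) ℂ) :
    slotGen lnk pol e (Y + Y') = slotGen lnk pol e Y + slotGen lnk pol e Y' := by
  simp only [slotGen, ← Finset.sum_add_distrib]
  refine Finset.sum_congr rfl fun s _ => ?_
  split_ifs
  · rw [polM_add, ins_add]
  · simp
/-- Slot generators are real-linear in `Y`. [folklore] -/
theorem slotGen_smul_real (lnk : σ → E) (pol : σ → Bool) (e : E) (r : ℝ) (Y : Matrix (Fin n) (Fin n) ℂ) :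
    slotGen lnk pol e (r • Y) = (r : ℂ) • slotGen lnk pol e Y := by
  simp only [slotGen, Finset.smul_sum]
  refine Finset.sum_congr rfl fun s _ => ?_
  split_ifs
  · rw [polM_smul_real, ← Complex.coe_smul, ins_smul]
  · simp

/-- Slot generators of DIFFERENT links commute (disjoint slots). [folklore] -/
theorem slotGen_comm (lnk : σ → E) (pol : σ → Bool) {e e' : E} (h : e ≠ e')
    (Y Y' : Matrix (Fin n) (Fin n) ℂ) :
    slotGen lnk pol e Y * slotGen lnk pol e' Y' = slotGen lnk pol e' Y' * slotGen lnk pol e Y := by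
  simp only [slotGen, Finset.sum_mul, Finset.mul_sum]
  rw [Finset.sum_comm]
  refine Finset.sum_congr rfl fun s _ => Finset.sum_congr rfl fun s' _ => ?_
  split_ifs with h1 h2
  · exact ins_mul_ins_comm (fun hh => h (by rw [← h1, ← h2, hh])) _ _
  all_goals simp

/-- The slot-generator map is a Lie homomorphism: `[Y^{σ,e}, Y'^{σ,e}] = [Y, Y']^{σ,e}`. [folklore] -/
theorem slotGen_commutator (lnk : σ → E) (pol : σ → Bool) (e : E) (Y Y' : Matrix (Fin n) (Fin n) ℂ) :
    slotGen lnk pol e Y * slotGen lnk pol e Y' - slotGen lnk pol e Y' * slotGen lnk pol e Y =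
      slotGen lnk pol e (Y * Y' - Y' * Y) := by
  -- commutator of two sums whose off-diagonal terms commute
  have key : ∀ g g' : σ → Matrix (σ → Fin n) (σ → Fin n) ℂ, (∀ s s', s ≠ s' → g s * g' s' = g' s' * g s) →
      (∑ s, g s) * (∑ s, g' s) - (∑ s, g' s) * (∑ s, g s) = ∑ s, (g s * g' s - g' s * g s) := by
    intro g g' hc
    rw [Finset.sum_mul_sum, Finset.sum_mul_sum, Finset.sum_comm (f := fun s s' => g' s * g s'),
      ← Finset.sum_sub_distrib]
    refine Finset.sum_congr rfl fun s _ => ?_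
    rw [← Finset.sum_sub_distrib, Finset.sum_eq_single s]
    · intro s' _ hs'
      rw [hc s s' (Ne.symm hs'), sub_self]
    · simp
  have hcomm : ∀ s s', s ≠ s' →
      (if lnk s = e then ins s (polM (pol s) Y) else 0) * (if lnk s' = e then ins s' (polM (pol s') Y') else 0) =
      (if lnk s' = e then ins s' (polM (pol s') Y') else 0) * (if lnk s = e then ins s (polM (pol s) Y) else 0) := by
    intro s s' hss
    split_ifs with h1 h2
    · exact ins_mul_ins_comm hss _ _
    all_goals simp
  rw [slotGen, slotGen, slotGen, key _ _ hcomm]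
  refine Finset.sum_congr rfl fun s _ => ?_
  split_ifs with h1
  · rw [ins_commutator, show polM (pol s) (Y * Y' - Y' * Y) =
        polM (pol s) Y * polM (pol s) Y' - polM (pol s) Y' * polM (pol s) Y by
      cases pol s <;> simp [Matrix.map_sub, Matrix.map_mul]]
  · simp

/-- `Y^{σ,e} · R_σ(W)` is the sum over the slots of `e` of `R_σ` with `Ŷ Ŵ` at that slot. [ours] -/
theorem slotGen_mul_slotRep (lnk : σ → E) (pol : σ → Bool) (e : E) (Y : Matrix (Fin n) (Fin n) ℂ)
    (W : E → Matrix (Fin n) (Fin n) ℂ) :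
    slotGen lnk pol e Y * slotRep lnk pol W =
      ∑ s, if lnk s = e then
        kronPi (Function.update (fun s' => polM (pol s') (W (lnk s'))) s (polM (pol s) (Y * W e))) else 0 := by
  simp only [slotGen, Finset.sum_mul]
  refine Finset.sum_congr rfl fun s _ => ?_
  split_ifs with hs
  · rw [slotRep, ins_mul_kronPi, polM_mul, hs]
  · rw [Matrix.zero_mul]
end Generators

/-! ## §4. The derivative formula along link curves -/
section Derivative
variable [DecidableEq σ] {E : Type*} [DecidableEq E]
/-- Entry derivative of `t ↦ exp(tY)·M` at `0` (complex-valued, no matrix norm in the statement). [folklore] -/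
theorem hasDerivAt_exp_mul_apply (Y M : Matrix (Fin n) (Fin n) ℂ) (i j : Fin n) :
    HasDerivAt (fun t : ℝ => (NormedSpace.exp (t • Y) * M) i j) ((Y * M) i j) 0 := by
  open scoped Matrix.Norms.Operator in
  have h1 : HasDerivAt (fun t : ℝ => NormedSpace.exp (t • Y) * M) (Y * NormedSpace.exp ((0 : ℝ) • Y) * M) 0 :=
    (hasDerivAt_exp_smul_const' (𝕂 := ℝ) Y 0).mul_const M
  open scoped Matrix.Norms.Operator in
  have h2 : HasDerivAt (fun t : ℝ => (NormedSpace.exp (t • Y) * M) i j)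
      ((Matrix.entryLinearMap ℝ ℂ i j).toContinuousLinearMap (Y * NormedSpace.exp ((0 : ℝ) • Y) * M)) 0 :=
    ((Matrix.entryLinearMap ℝ ℂ i j).toContinuousLinearMap).hasFDerivAt.comp_hasDerivAt (0 : ℝ) h1
  refine h2.congr_deriv ?_
  simp

/-- The same with a polarity applied (conjugation is real-linear and continuous). [folklore] -/
theorem hasDerivAt_polM_exp_mul_apply (b : Bool) (Y M : Matrix (Fin n) (Fin n) ℂ) (i j : Fin n) :
    HasDerivAt (fun t : ℝ => polM b (NormedSpace.exp (t • Y) * M) i j) (polM b (Y * M) i j) 0 := by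
  cases b
  · simpa [Matrix.map_apply] using (hasDerivAt_exp_mul_apply Y M i j).star
  · simpa using hasDerivAt_exp_mul_apply Y M i j

/-- **Derivative formula (E1).** Along the link curve `t ↦ update W e (exp(tY) · W e)` every entry of the
slot representation has derivative `(Y^{σ,e} · R_σ(W))_{I,J}` at `t = 0` — for EVERY ambient configuration
`W` (no unitarity needed). [ours] -/
theorem hasDerivAt_slotRep_apply (lnk : σ → E) (pol : σ → Bool) (W : E → Matrix (Fin n) (Fin n) ℂ) (e : E)
    (Y : Matrix (Fin n) (Fin n) ℂ) (I J : σ → Fin n) :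
    HasDerivAt (fun t : ℝ => slotRep lnk pol (Function.update W e (NormedSpace.exp (t • Y) * W e)) I J)
      ((slotGen lnk pol e Y * slotRep lnk pol W) I J) 0 := by
  -- slot factors and their derivatives
  set f : σ → ℝ → ℂ := fun s t =>
    polM (pol s) (Function.update W e (NormedSpace.exp (t • Y) * W e) (lnk s)) (I s) (J s) with hf
  set f' : σ → ℂ := fun s => if lnk s = e then polM (pol s) (Y * W e) (I s) (J s) else 0 with hf'
  have hderiv : ∀ s ∈ (univ : Finset σ), HasDerivAt (f s) (f' s) 0 := by
    intro s _
    by_cases hs : lnk s = e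
    · have : f s = fun t => polM (pol s) (NormedSpace.exp (t • Y) * W e) (I s) (J s) := by
        funext t; simp only [hf, hs, Function.update_self]
      rw [this, hf']
      simp only [hs, if_true]
      exact hasDerivAt_polM_exp_mul_apply _ _ _ _ _
    · have : f s = fun _ => polM (pol s) (W (lnk s)) (I s) (J s) := by
        funext t; simp only [hf, Function.update_of_ne hs]
      rw [this, hf']
      simp only [hs, if_false]
      exact hasDerivAt_const _ _
  have hprod := HasDerivAt.fun_finsetProd hderiv
  -- the function is the product of the slot factors
  have hfun : (fun t : ℝ => slotRep lnk pol (Function.update W e (NormedSpace.exp (t • Y) * W e)) I J) =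
      fun t => ∏ s ∈ univ, f s t := by
    funext t; simp only [slotRep, kronPi_apply, hf]
  -- values of the factors at `t = 0`
  have hf0 : ∀ s, f s 0 = polM (pol s) (W (lnk s)) (I s) (J s) := by
    intro s
    simp only [hf, zero_smul, NormedSpace.exp_zero, one_mul, Function.update_eq_self]
  rw [hfun]
  refine hprod.congr_deriv ?_
  rw [slotGen_mul_slotRep, Matrix.sum_apply]
  refine Finset.sum_congr rfl fun s _ => ?_
  by_cases hs : lnk s = e
  · simp only [hs, if_true, kronPi_update_apply, hf', hf0, smul_eq_mul]
    ring
  · simp [hs, hf']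

/-- **Coefficient functions are closed under link derivatives**: for any coefficient array `a`,
`d/dt|₀ ∑_{I,J} a I J · R_σ(W_t)_{I,J} = ∑_{I,J} a I J · (Y^{σ,e} R_σ(W))_{I,J}`. [ours] -/
theorem hasDerivAt_sum_mul_slotRep (lnk : σ → E) (pol : σ → Bool) (W : E → Matrix (Fin n) (Fin n) ℂ) (e : E)
    (Y : Matrix (Fin n) (Fin n) ℂ) (a : (σ → Fin n) → (σ → Fin n) → ℂ) :
    HasDerivAt (fun t : ℝ => ∑ I, ∑ J, a I J *
        slotRep lnk pol (Function.update W e (NormedSpace.exp (t • Y) * W e)) I J)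
      (∑ I, ∑ J, a I J * (slotGen lnk pol e Y * slotRep lnk pol W) I J) 0 := by
  refine HasDerivAt.fun_sum fun I _ => HasDerivAt.fun_sum fun J _ => ?_
  exact (hasDerivAt_slotRep_apply lnk pol W e Y I J).const_mul (a I J)
end Derivative
end Summit.Ventures.LatticeQCDFlow.TrivializingMaps.SlotRepresentation
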